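import Literature.NumberTheory.LFunctions.ZetaScaleTwistedPrimeSumTail
import Literature.NumberTheory.Sieve.MatomakiRadziwillLemma11Zeta
import Literature.NumberTheory.Sieve.MatomakiRadziwillTheorem3VK
import HarnessLib

/-!
# Matomäki–Radziwiłł 2016, Theorems 1 and 3 from a zero-free region for `ζ` ALONE (e.g. Ford's bound)

Topic `Literature/NumberTheory/Sieve`.  Everything in this file is PROVED; no definitions, no named facts.

K. Matomäki, M. Radziwiłł, *Multiplicative functions in short intervals*, Ann. of Math. (2) 183 (2016):
Theorem 3 (the named fact `MatomakiRadziwill2016_theorem3`), Theorem 1 (`MatomakiRadziwill2016_theorem1`)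
and parity.S38 (`matomaki_radziwill`).  After `MatomakiRadziwillTheorem3VK.lean` their trust base in
the tree was ONE input, a Vinogradov–Korobov zero-free region for all Dirichlet `L`-functions
(`HasVKZeroFreeRegion c T₀`; e.g. Khale's `Khale2024_zeroFreeRegion`, or Richert-type bounds for `ζ`
AND for the `L(s, χ)` through `hasVKZeroFreeRegion_of_richert`).  The paper uses the zero-free region
of the Riemann zeta function only (Lemma 2, Lemma 11), and so does the tree's proof: the region enters
through the level-one character alone.  With the `ζ`-only re-run of that input
(`ZetaScaleTwistedSum.lean`, `ZetaScaleTwistedPrimeSumTail.lean`, `MatomakiRadziwillLemma11Zeta.lean`: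
everything from scale-wise zero-freeness of `ζ₁`, the inline hypothesis
`hZ : ∀ η > 2/3, ∀ᶠ X, ∀ s, |Im s| ≤ 3X → Re s ≥ 1 − (log X)^{-η} → ζ₁ s ≠ 0`) this file assembles:

* `MatomakiRadziwill2016_lemma3_of_scale`, `…_prop1_of_scale`, `…_theorem3_of_scale`,
  `…_theorem1_of_scale`, `matomaki_radziwill_of_scale` — Lemma 3, Proposition 1, Theorem 3, Theorem 1
  and parity.S38 from `hZ` alone (Lemma 4 and Lemma 14 being proved: `MatomakiRadziwill2016_lemma4_holds`,
  `MatomakiRadziwill2016_lemma14_real_holds`; assemblies `MatomakiRadziwill2016_lemma3_of_GS_tail`,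
  `…_prop1_of_lemma3_lemma11`, `…_theorem3_of_prop1_real`, `…_theorem1_of_theorem3`,
  `matomaki_radziwill_of_theorem1`);
* `…_of_zetaRegion` — the same from ANY zero-free region `ζ(σ + it) ≠ 0`, `|t| ≥ T₀`,
  `σ ≥ 1 − c/((log|t|)^{2/3}(log log|t|)^{1/3})` (`c > 0`; inexplicit constants, `ζ` only — the
  classical Vinogradov–Korobov theorem as printed in Titchmarsh §6.19 / Ivić Ch. 6);
* `…_of_richertType` — the same from any Richert-type bound `|ζ(σ + it)| ≤ A|t|^{B(1−σ)^{3/2}}(log|t|)^P`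
  for `ζ` alone (`VKFromRichert.zeta_zeroFree_of_richertType`);
* `…_of_ford` — **the same from Ford's Theorem 1 alone** (`zeta_bound_ford`:
  `|ζ(σ + it)| ≤ 76.2 t^{4.45(1−σ)^{3/2}}(log t)^{2/3}`), through the inexplicit region it yields
  (`zeta_zeroFree_of_zeta_bound_ford`, Titchmarsh Thm 3.10).

So `MatomakiRadziwill2016_theorem3_holds` (and `…theorem1_holds`, parity.S38) now wait on exactly one
named fact about `ζ` alone — `zeta_bound_ford`, or any Vinogradov–Korobov region / Richert-type bound
for `ζ` fed to `…_of_zetaRegion` — instead of a region for all Dirichlet `L`-functions.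

## References
* K. Matomäki, M. Radziwiłł, Ann. of Math. (2) 183 (2016), 1015–1056, doi:10.4007/annals.2016.183.3.6
  (arXiv:1501.04585): Theorem 3 (p. 6; proof §9, p. 19), Theorem 1, Proposition 1 (§8), Lemmas 2, 3, 4,
  11, 14. [MatomakiRadziwillAnnals2016]
* K. Ford, *Vinogradov's integral and bounds for the Riemann zeta function*, Proc. LMS 85 (2002),
  Theorem 1. [Ford2002]
* E. C. Titchmarsh, *The Theory of the Riemann Zeta-Function*, 2nd ed., Thm 3.10, §6.19. [Titchmarsh1986]
-/

noncomputable section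

open Complex Filter

namespace Literature.NumberTheory.Sieve

open Literature.NumberTheory.LFunctions Literature.NumberTheory.LFunctions.GranvilleSoundararajan

/-! ### From scale-wise zero-freeness of `ζ₁` -/

/-- **Matomäki–Radziwiłł 2016, Lemma 3, from a zero-free region for `ζ` alone** (scale-wise form):
`MatomakiRadziwill2016_lemma3_of_GS_tail` with the proved sharp Halász theorem
`GranvilleSoundararajan2003_theorem1_holds` and the prime tail
`ZetaScale.pretentiousDistSq_one_twist_tail_ge_of_scale` at `θ = 7/10`.
[cite: MatomakiRadziwillAnnals2016, Lemma 3] -/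
theorem MatomakiRadziwill2016_lemma3_of_scale
    (hZ : ∀ η : ℝ, 2 / 3 < η → ∀ᶠ X : ℝ in atTop, ∀ s : ℂ, |s.im| ≤ 3 * X →
      1 - Real.log X ^ (-η) ≤ s.re → riemannZeta₁ s ≠ 0) :
    MatomakiRadziwill2016_lemma3 :=
  MatomakiRadziwill2016_lemma3_of_GS_tail GranvilleSoundararajan2003_theorem1_holds
    (ZetaScale.pretentiousDistSq_one_twist_tail_ge_of_scale hZ (θ := 7 / 10) (by norm_num))

/-- **Matomäki–Radziwiłł 2016, Proposition 1, from a zero-free region for `ζ` alone** (scale-wise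
form): the proved §8 assembly `MatomakiRadziwill2016_prop1_of_lemma3_lemma11` with
`MatomakiRadziwill2016_lemma3_of_scale` and `MatomakiRadziwill2016_lemma11_of_scale`.
[cite: MatomakiRadziwillAnnals2016, Proposition 1] -/
theorem MatomakiRadziwill2016_prop1_of_scale
    (hZ : ∀ η : ℝ, 2 / 3 < η → ∀ᶠ X : ℝ in atTop, ∀ s : ℂ, |s.im| ≤ 3 * X →
      1 - Real.log X ^ (-η) ≤ s.re → riemannZeta₁ s ≠ 0) :
    MatomakiRadziwill2016_prop1 :=
  MatomakiRadziwill2016_prop1_of_lemma3_lemma11 (MatomakiRadziwill2016_lemma3_of_scale hZ)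
    (MatomakiRadziwill2016_lemma11_of_scale hZ)

/-- **Matomäki–Radziwiłł 2016, Theorem 3, from a zero-free region for `ζ` alone** (scale-wise form):
§9 of the paper (`MatomakiRadziwill2016_theorem3_of_prop1_real`) with Lemma 14 and Lemma 4 proved and
Proposition 1 from `hZ`. [cite: MatomakiRadziwillAnnals2016, Theorem 3 and §9] -/
theorem MatomakiRadziwill2016_theorem3_of_scale
    (hZ : ∀ η : ℝ, 2 / 3 < η → ∀ᶠ X : ℝ in atTop, ∀ s : ℂ, |s.im| ≤ 3 * X →
      1 - Real.log X ^ (-η) ≤ s.re → riemannZeta₁ s ≠ 0) :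
    MatomakiRadziwill2016_theorem3 :=
  MatomakiRadziwill2016_theorem3_of_prop1_real MatomakiRadziwill2016_lemma14_real_holds
    MatomakiRadziwill2016_lemma4_holds (MatomakiRadziwill2016_prop1_of_scale hZ)

/-- **Matomäki–Radziwiłł 2016, Theorem 1, from a zero-free region for `ζ` alone** (scale-wise form),
through the proved `MatomakiRadziwill2016_theorem1_of_theorem3`. [cite: MatomakiRadziwillAnnals2016, Theorem 1] -/
theorem MatomakiRadziwill2016_theorem1_of_scale
    (hZ : ∀ η : ℝ, 2 / 3 < η → ∀ᶠ X : ℝ in atTop, ∀ s : ℂ, |s.im| ≤ 3 * X →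
      1 - Real.log X ^ (-η) ≤ s.re → riemannZeta₁ s ≠ 0) :
    MatomakiRadziwill2016_theorem1 :=
  MatomakiRadziwill2016_theorem1_of_theorem3 (MatomakiRadziwill2016_theorem3_of_scale hZ)

/-- **parity.S38 (`matomaki_radziwill`) from a zero-free region for `ζ` alone** (scale-wise form).
[cite: MatomakiRadziwillAnnals2016, Theorem 1] -/
theorem matomaki_radziwill_of_scale
    (hZ : ∀ η : ℝ, 2 / 3 < η → ∀ᶠ X : ℝ in atTop, ∀ s : ℂ, |s.im| ≤ 3 * X →
      1 - Real.log X ^ (-η) ≤ s.re → riemannZeta₁ s ≠ 0) :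
    matomaki_radziwill :=
  matomaki_radziwill_of_theorem1 (MatomakiRadziwill2016_theorem1_of_scale hZ)

/-! ### From a Vinogradov–Korobov zero-free region for `ζ` alone (inexplicit constants) -/

/-- **Matomäki–Radziwiłł 2016, Proposition 1, from any Vinogradov–Korobov zero-free region for `ζ`**:
`c > 0` and `ζ(s) ≠ 0` for `|Im s| ≥ T₀`, `Re s ≥ 1 − c/((log|Im s|)^{2/3}(log log|Im s|)^{1/3})`.
[cite: MatomakiRadziwillAnnals2016, Proposition 1] [cite: Titchmarsh1986, §6.19] -/
theorem MatomakiRadziwill2016_prop1_of_zetaRegion {c T₀ : ℝ} (hc : 0 < c)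
    (hR : ∀ s : ℂ, T₀ ≤ |s.im| →
      1 - c / (Real.log |s.im| ^ (2 / 3 : ℝ) * Real.log (Real.log |s.im|) ^ (1 / 3 : ℝ)) ≤ s.re →
        riemannZeta s ≠ 0) :
    MatomakiRadziwill2016_prop1 :=
  MatomakiRadziwill2016_prop1_of_scale (ZetaScale.scaleZeroFree_of_zetaRegion hc hR)

/-- **Matomäki–Radziwiłł 2016, Theorem 3, from any Vinogradov–Korobov zero-free region for `ζ`** (the
paper's actual analytic input: "the zero-free region for the Riemann zeta-function", Lemmas 2 and 11).
[cite: MatomakiRadziwillAnnals2016, Theorem 3] [cite: Titchmarsh1986, §6.19] -/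
theorem MatomakiRadziwill2016_theorem3_of_zetaRegion {c T₀ : ℝ} (hc : 0 < c)
    (hR : ∀ s : ℂ, T₀ ≤ |s.im| →
      1 - c / (Real.log |s.im| ^ (2 / 3 : ℝ) * Real.log (Real.log |s.im|) ^ (1 / 3 : ℝ)) ≤ s.re →
        riemannZeta s ≠ 0) :
    MatomakiRadziwill2016_theorem3 :=
  MatomakiRadziwill2016_theorem3_of_scale (ZetaScale.scaleZeroFree_of_zetaRegion hc hR)

/-- **Matomäki–Radziwiłł 2016, Theorem 1, from any Vinogradov–Korobov zero-free region for `ζ`.**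
[cite: MatomakiRadziwillAnnals2016, Theorem 1] [cite: Titchmarsh1986, §6.19] -/
theorem MatomakiRadziwill2016_theorem1_of_zetaRegion {c T₀ : ℝ} (hc : 0 < c)
    (hR : ∀ s : ℂ, T₀ ≤ |s.im| →
      1 - c / (Real.log |s.im| ^ (2 / 3 : ℝ) * Real.log (Real.log |s.im|) ^ (1 / 3 : ℝ)) ≤ s.re →
        riemannZeta s ≠ 0) :
    MatomakiRadziwill2016_theorem1 :=
  MatomakiRadziwill2016_theorem1_of_scale (ZetaScale.scaleZeroFree_of_zetaRegion hc hR)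

/-- **parity.S38 (`matomaki_radziwill`) from any Vinogradov–Korobov zero-free region for `ζ`.**
[cite: MatomakiRadziwillAnnals2016, Theorem 1] [cite: Titchmarsh1986, §6.19] -/
theorem matomaki_radziwill_of_zetaRegion {c T₀ : ℝ} (hc : 0 < c)
    (hR : ∀ s : ℂ, T₀ ≤ |s.im| →
      1 - c / (Real.log |s.im| ^ (2 / 3 : ℝ) * Real.log (Real.log |s.im|) ^ (1 / 3 : ℝ)) ≤ s.re →
        riemannZeta s ≠ 0) :
    matomaki_radziwill :=
  matomaki_radziwill_of_scale (ZetaScale.scaleZeroFree_of_zetaRegion hc hR)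

/-! ### From a Richert-type bound for `ζ` alone -/

/-- **Matomäki–Radziwiłł 2016, Proposition 1, from a Richert-type bound for `ζ` alone**
(`|ζ(σ + it)| ≤ A|t|^{B(1−σ)^{3/2}}(log|t|)^P`, `|t| ≥ 3`, `1/2 ≤ σ ≤ 1`, any `P ≥ 0` — the shape
delivered by Vinogradov's exponential-sum estimate), through the inexplicit Vinogradov–Korobov region it
yields (`VKFromRichert.zeta_zeroFree_of_richertType`, Titchmarsh Thm 3.10 / §6.19).
[cite: MatomakiRadziwillAnnals2016, Proposition 1] [cite: Titchmarsh1986, Theorem 3.10 and §6.19] -/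
theorem MatomakiRadziwill2016_prop1_of_richertType {A B P : ℝ} (hRζ : RichertTypeBound A B P)
    (hP : 0 ≤ P) : MatomakiRadziwill2016_prop1 := by
  obtain ⟨c, hc, hR⟩ := VKFromRichert.zeta_zeroFree_of_richertType hRζ hP
  exact MatomakiRadziwill2016_prop1_of_zetaRegion hc hR

/-- **Matomäki–Radziwiłł 2016, Theorem 3, from a Richert-type bound for `ζ` alone.**
[cite: MatomakiRadziwillAnnals2016, Theorem 3] [cite: Titchmarsh1986, Theorem 3.10 and §6.19] -/
theorem MatomakiRadziwill2016_theorem3_of_richertType {A B P : ℝ} (hRζ : RichertTypeBound A B P)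
    (hP : 0 ≤ P) : MatomakiRadziwill2016_theorem3 := by
  obtain ⟨c, hc, hR⟩ := VKFromRichert.zeta_zeroFree_of_richertType hRζ hP
  exact MatomakiRadziwill2016_theorem3_of_zetaRegion hc hR

/-- **Matomäki–Radziwiłł 2016, Theorem 1, from a Richert-type bound for `ζ` alone.**
[cite: MatomakiRadziwillAnnals2016, Theorem 1] [cite: Titchmarsh1986, Theorem 3.10 and §6.19] -/
theorem MatomakiRadziwill2016_theorem1_of_richertType {A B P : ℝ} (hRζ : RichertTypeBound A B P)
    (hP : 0 ≤ P) : MatomakiRadziwill2016_theorem1 := by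
  obtain ⟨c, hc, hR⟩ := VKFromRichert.zeta_zeroFree_of_richertType hRζ hP
  exact MatomakiRadziwill2016_theorem1_of_zetaRegion hc hR

/-- **parity.S38 (`matomaki_radziwill`) from a Richert-type bound for `ζ` alone.**
[cite: MatomakiRadziwillAnnals2016, Theorem 1] [cite: Titchmarsh1986, Theorem 3.10 and §6.19] -/
theorem matomaki_radziwill_of_richertType {A B P : ℝ} (hRζ : RichertTypeBound A B P) (hP : 0 ≤ P) :
    matomaki_radziwill := by
  obtain ⟨c, hc, hR⟩ := VKFromRichert.zeta_zeroFree_of_richertType hRζ hP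
  exact matomaki_radziwill_of_zetaRegion hc hR

/-! ### From Ford's bound for `ζ` alone -/

/-- **Matomäki–Radziwiłł 2016, Proposition 1, from Ford's Theorem 1 alone** (`zeta_bound_ford`; the
earlier `MatomakiRadziwill2016_prop1_of_ford_lemma11` / `…_of_ford_khale` needed Lemma 11, resp. Khale's
region, in addition). [cite: MatomakiRadziwillAnnals2016, Proposition 1] [cite: Ford2002, Theorem 1] -/
theorem MatomakiRadziwill2016_prop1_of_ford (hF : zeta_bound_ford) : MatomakiRadziwill2016_prop1 :=
  MatomakiRadziwill2016_prop1_of_scale (ZetaScale.scaleZeroFree_of_ford hF)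

/-- **Matomäki–Radziwiłł 2016, Theorem 3, from Ford's Theorem 1 alone** (`zeta_bound_ford`): the trust
base of Theorem 3 in the tree is now this single named fact about `ζ`.
[cite: MatomakiRadziwillAnnals2016, Theorem 3] [cite: Ford2002, Theorem 1] -/
theorem MatomakiRadziwill2016_theorem3_of_ford (hF : zeta_bound_ford) : MatomakiRadziwill2016_theorem3 :=
  MatomakiRadziwill2016_theorem3_of_scale (ZetaScale.scaleZeroFree_of_ford hF)

/-- **Matomäki–Radziwiłł 2016, Theorem 1, from Ford's Theorem 1 alone** (`zeta_bound_ford`).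
[cite: MatomakiRadziwillAnnals2016, Theorem 1] [cite: Ford2002, Theorem 1] -/
theorem MatomakiRadziwill2016_theorem1_of_ford (hF : zeta_bound_ford) : MatomakiRadziwill2016_theorem1 :=
  MatomakiRadziwill2016_theorem1_of_scale (ZetaScale.scaleZeroFree_of_ford hF)

/-- **parity.S38 (`matomaki_radziwill`) from Ford's Theorem 1 alone** (`zeta_bound_ford`).
[cite: MatomakiRadziwillAnnals2016, Theorem 1] [cite: Ford2002, Theorem 1] -/
theorem matomaki_radziwill_of_ford (hF : zeta_bound_ford) : matomaki_radziwill :=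
  matomaki_radziwill_of_scale (ZetaScale.scaleZeroFree_of_ford hF)

end Literature.NumberTheory.Sieve
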